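import Summits.ResolutionOfSingularities.ResolutionOfSingularities.Theorems.WildQuotientsSummitReductionStubPairOrbitNormalFormBlowupModelCharts
import Literature.AlgebraicGeometry.Resolution.AlterationsSemiStableCodimTwoBlowupFlat
import Literature.AlgebraicGeometry.Resolution.NodalPowRingSingularLocus
import Literature.AlgebraicGeometry.Resolution.RegularLocalRingsQuotient
import Literature.NumberTheory.GaloisRepresentations.NearlyOrdinaryPresentationProofs
import Mathlib.RingTheory.Flat.TorsionFree
import Mathlib.RingTheory.Filtration
import HarnessLib

/-!
# `WildQuotients.SummitReduction` (stmt-ResolutionOfSingularities-16324), line `FramePerfect`, stub O3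
# (`stub_pair_orbitNormalFormBlowup_chartsOverCentre`): the normal-form ring is reduced and its
# boundary ideal is radical

Route `ResolutionOfSingularities/WildQuotients`, crux `SummitReduction`; helper file of stub O3
(de Jong 1996, 4.27 [C2], coefficient-free model). To identify the completed ideal of the
(reduced) boundary with the IDEAL `(t₁ ⋯ t_r)` of the model ring `D⟦u, v⟧/(uv - t₁ ⋯ t_s)`
(normal form 2.16/4.25: "`Z` is given by `t₁ ⋯ t_r = 0`"), `D` regular local with regular
system of parameters containing the `tᵢ`, this ideal must be radical. PROVED here:
`D⟦u, v⟧/(uv - h)` is flat over `D` (3.3), so parameters stay non-zero-divisors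
(`chartsOverCentre_ofBase_mem_nonZeroDivisors`); `(D⟦u, v⟧/(uv - h))/(t) ≅ (D/t)⟦u, v⟧/(uv - h̄)`
(`chartsOverCentre_nodeDeformationRing_quot`); a Noetherian local ring reduced modulo a regular
parameter is reduced (`chartsOverCentre_isReduced_of_quotient`, Krull); the formal node
`E⟦u, v⟧/(uv)` over a domain is reduced; hence **`D⟦u, v⟧/(uv - ∏_{k ∈ S} t_k)` is reduced**
(`S ≠ ∅`; `chartsOverCentre_isReduced_nodeDeformationRing`) and **`(∏_{k ∈ R} t_k)` is a radical
ideal of it** (`chartsOverCentre_isRadical_span_ofBase_prod`: the intersection of the `(tᵢ)`).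

## Sources

* A. J. de Jong, *Smoothness, semi-stability and alterations*, Publ. Math. IHÉS 83 (1996), 2.16,
  2.23, 3.3–3.5, 4.25, pp. 59–64, 75. [DeJong1996]
* H. Matsumura, *Commutative Ring Theory* (1986), Thm. 8.10. [Matsumura1987]
-/
set_option linter.dupNamespace false -- the tree's summit namespace repeats `ResolutionOfSingularities`

noncomputable section

open IsLocalRing
open Literature.AlgebraicGeometry.Resolution

namespace Summit.ResolutionOfSingularities.ResolutionOfSingularities.Theorems

/-- **`A⟦u, v⟧/(uv - h)` is flat over `A`** (`A` Noetherian): `A[u, v]/(uv - h)` is free over `A`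
and `A⟦u, v⟧/(uv - h)` is flat over it (de Jong 1996, 3.3). [cite: DeJong1996, 3.3, p. 63] -/
theorem chartsOverCentre_flat_nodeDeformationRing (A : Type) [CommRing A] [IsNoetherianRing A] (h : A) :
    Module.Flat A (DeJong1996.NodeDeformationRing A h) := by
  let φ := (DeJong1996.AlgebraicNodeRing.toNodeDeformationRing A h).toRingHom
  letI : Algebra (DeJong1996.AlgebraicNodeRing A h) (DeJong1996.NodeDeformationRing A h) := φ.toAlgebra
  haveI : IsScalarTower A (DeJong1996.AlgebraicNodeRing A h) (DeJong1996.NodeDeformationRing A h) :=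
    IsScalarTower.of_algebraMap_eq fun a => by
      change algebraMap A _ a = (DeJong1996.AlgebraicNodeRing.toNodeDeformationRing A h) (algebraMap A _ a)
      rw [AlgHom.commutes]
  haveI : Module.Flat (DeJong1996.AlgebraicNodeRing A h) (DeJong1996.NodeDeformationRing A h) :=
    RingHom.flat_algebraMap_iff.mp (DeJong1996.AlgebraicNodeRing.flat_toNodeDeformationRing A h)
  exact Module.Flat.trans A (DeJong1996.AlgebraicNodeRing A h) (DeJong1996.NodeDeformationRing A h)

/-- Constants which are non-zero-divisors of `A` stay non-zero-divisors of `A⟦u, v⟧/(uv - h)`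
(flatness). [cite: DeJong1996, 3.3, p. 63] -/
theorem chartsOverCentre_ofBase_mem_nonZeroDivisors (A : Type) [CommRing A] [IsNoetherianRing A] (h : A)
    {t : A} (ht : t ∈ nonZeroDivisors A) :
    DeJong1996.NodeDeformationRing.ofBase A h t ∈ nonZeroDivisors (DeJong1996.NodeDeformationRing A h) := by
  haveI := chartsOverCentre_flat_nodeDeformationRing A h
  have hreg := Module.Flat.isSMulRegular_of_nonZeroDivisors (M := DeJong1996.NodeDeformationRing A h) ht
  have halg : ∀ a, algebraMap A (DeJong1996.NodeDeformationRing A h) a = DeJong1996.NodeDeformationRing.ofBase A h a :=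
    fun a => rfl
  have key : ∀ y : DeJong1996.NodeDeformationRing A h,
      DeJong1996.NodeDeformationRing.ofBase A h t * y = 0 → y = 0 := by
    intro y hy
    apply hreg
    change t • y = t • (0 : DeJong1996.NodeDeformationRing A h)
    rw [smul_zero, show t • y = algebraMap A _ t * y from Algebra.smul_def t y, halg, hy]
  rw [mem_nonZeroDivisors_iff]
  exact ⟨key, fun y hy => key y (by rw [mul_comm]; exact hy)⟩

/-- **`(A⟦u, v⟧/(uv - h))/(t) ≅ (A/t)⟦u, v⟧/(uv - h̄)`**: reduce the coefficients modulo `t`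
(`A⟦u, v⟧/(t) = (A/t)⟦u, v⟧`, tree `ker_map_mk_span_singleton_eq`). [cite: DeJong1996, 3.5, p. 64] -/
theorem chartsOverCentre_nodeDeformationRing_quot (A : Type) [CommRing A] (h t : A) :
    ∃ ε : (DeJong1996.NodeDeformationRing A h ⧸
        Ideal.span {DeJong1996.NodeDeformationRing.ofBase A h t}) ≃+*
        DeJong1996.NodeDeformationRing (A ⧸ Ideal.span {t}) (Ideal.Quotient.mk _ h),
      (∀ a : A, ε (Ideal.Quotient.mk _ (DeJong1996.NodeDeformationRing.ofBase A h a)) =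
        DeJong1996.NodeDeformationRing.ofBase _ _ (Ideal.Quotient.mk _ a)) := by
  obtain ⟨hker, hsurj⟩ := ker_map_mk_span_singleton_eq 2 t
  -- the composite surjection `A⟦u, v⟧ → (A/t)⟦u, v⟧ → (A/t)⟦u, v⟧/(uv - h̄)`
  let Φ : MvPowerSeries (Fin 2) A →+* DeJong1996.NodeDeformationRing (A ⧸ Ideal.span {t}) (Ideal.Quotient.mk _ h) :=
    (Ideal.Quotient.mk _).comp (MvPowerSeries.map (σ := Fin 2) (Ideal.Quotient.mk (Ideal.span {t})))
  have hΦsurj : Function.Surjective Φ := Ideal.Quotient.mk_surjective.comp hsurj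
  have hrel : MvPowerSeries.map (σ := Fin 2) (Ideal.Quotient.mk (Ideal.span {t}))
      (DeJong1996.nodeDeformationRelation A h) =
      DeJong1996.nodeDeformationRelation (A ⧸ Ideal.span {t}) (Ideal.Quotient.mk _ h) := by
    simp only [DeJong1996.nodeDeformationRelation, map_sub, map_mul, MvPowerSeries.map_X, MvPowerSeries.map_C]
  have hkerΦ : RingHom.ker Φ = Ideal.span {DeJong1996.nodeDeformationRelation A h} ⊔
      Ideal.span {MvPowerSeries.C t} := by
    change RingHom.ker ((Ideal.Quotient.mk _).comp _) = _
    rw [← RingHom.comap_ker, Ideal.mk_ker, ← hrel, ← Set.image_singleton, ← Ideal.map_span,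
      Ideal.comap_map_of_surjective _ hsurj, ← RingHom.ker_eq_comap_bot, hker]
  -- `N/(t) = A⟦u, v⟧/((uv - h) + (C t))`
  have hmap : (Ideal.span {MvPowerSeries.C (σ := Fin 2) t}).map
      (Ideal.Quotient.mk (Ideal.span {DeJong1996.nodeDeformationRelation A h})) =
      Ideal.span {DeJong1996.NodeDeformationRing.ofBase A h t} := by
    rw [Ideal.map_span, Set.image_singleton]; rfl
  let e₁ : (DeJong1996.NodeDeformationRing A h ⧸ Ideal.span {DeJong1996.NodeDeformationRing.ofBase A h t}) ≃+*
      (DeJong1996.NodeDeformationRing A h ⧸ (Ideal.span {MvPowerSeries.C (σ := Fin 2) t}).map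
        (Ideal.Quotient.mk (Ideal.span {DeJong1996.nodeDeformationRelation A h}))) :=
    Ideal.quotEquivOfEq hmap.symm
  let e₂ := DoubleQuot.quotQuotEquivQuotSup (Ideal.span {DeJong1996.nodeDeformationRelation A h})
    (Ideal.span {MvPowerSeries.C (σ := Fin 2) t})
  let e₃ := Ideal.quotEquivOfEq hkerΦ.symm
  let e₄ := RingHom.quotientKerEquivOfSurjective hΦsurj
  refine ⟨e₁.trans (e₂.trans (e₃.trans e₄)), fun a => ?_⟩
  have h2 : e₂ (e₁ (Ideal.Quotient.mk _ (DeJong1996.NodeDeformationRing.ofBase A h a))) =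
      Ideal.Quotient.mk _ (MvPowerSeries.C a) :=
    DoubleQuot.quotQuotEquivQuotSup_quotQuotMk _ _ (MvPowerSeries.C a)
  have h4 : e₄ (e₃ (Ideal.Quotient.mk _ (MvPowerSeries.C a))) = Φ (MvPowerSeries.C a) :=
    RingHom.quotientKerEquivOfSurjective_apply_mk hΦsurj _
  rw [RingEquiv.trans_apply, RingEquiv.trans_apply, RingEquiv.trans_apply, h2, h4]
  change Ideal.Quotient.mk _ (MvPowerSeries.map _ (MvPowerSeries.C a)) = _
  rw [MvPowerSeries.map_C]
  rfl

/-- **Reducedness modulo a regular parameter lifts**: for a Noetherian local ring `R`, `t ∈ 𝔪_R`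
a non-zero-divisor with `R/(t)` reduced, `R` is reduced (a nilpotent lies in `⋂ₙ (tⁿ) = 0`).
[cite: Matsumura1987, Thm. 8.10] -/
theorem chartsOverCentre_isReduced_of_quotient {R : Type} [CommRing R] [IsNoetherianRing R] [IsLocalRing R]
    {t : R} (htm : t ∈ maximalIdeal R) (ht : t ∈ nonZeroDivisors R)
    (hred : IsReduced (R ⧸ Ideal.span {t})) : IsReduced R := by
  refine ⟨fun g hg => ?_⟩
  obtain ⟨n, hn⟩ := hg
  -- `g ∈ (t^k)` for all `k`
  have hk : ∀ k : ℕ, ∃ g' : R, g = t ^ k * g' ∧ g' ^ n = 0 := fun k => by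
    induction k with
    | zero => exact ⟨g, by simp, hn⟩
    | succ k ih =>
      obtain ⟨g', hg', hn'⟩ := ih
      have hnil : IsNilpotent (Ideal.Quotient.mk (Ideal.span {t}) g') := ⟨n, by rw [← map_pow, hn', map_zero]⟩
      have h0 := hred.eq_zero _ hnil
      rw [Ideal.Quotient.eq_zero_iff_mem, Ideal.mem_span_singleton'] at h0
      obtain ⟨g'', rfl⟩ := h0
      refine ⟨g'', by rw [hg']; ring, ?_⟩
      have : t ^ n * g'' ^ n = 0 := by rw [← mul_pow, mul_comm]; exact hn'
      exact (mul_left_mem_nonZeroDivisors_eq_zero_iff (pow_mem ht n)).mp this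
  have hmem : ∀ k, g ∈ maximalIdeal R ^ k := fun k => by
    obtain ⟨g', hg', -⟩ := hk k
    exact hg' ▸ Ideal.mul_mem_right _ _ (Ideal.pow_mem_pow htm k)
  have hg0 : g ∈ (⨅ k, maximalIdeal R ^ k) := Ideal.mem_iInf.mpr hmem
  rwa [Ideal.iInf_pow_eq_bot_of_isLocalRing (maximalIdeal R) (maximalIdeal.isMaximal R).ne_top,
    Ideal.mem_bot] at hg0

/-- A variable of `E⟦X₀, X₁⟧` over a domain is a prime element. [folklore] -/
theorem chartsOverCentre_prime_X {E : Type} [CommRing E] [IsDomain E] (i : Fin 2) :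
    Prime (MvPowerSeries.X i : MvPowerSeries (Fin 2) E) := by
  -- adapted from `MvPowerSeries.prime_X'` (field case)
  classical
  have hne : (MvPowerSeries.X i : MvPowerSeries (Fin 2) E) ≠ 0 := fun h => by
    simpa [MvPowerSeries.coeff_X] using congrArg (MvPowerSeries.coeff (Finsupp.single i 1)) h
  rw [← Ideal.span_singleton_prime hne]
  have h := MvPowerSeries.isPrime_span_X_image (R := E) (Function.Embedding.subtype (· ≠ i)) {i}
    (fun s => by
      simp only [Finset.mem_singleton, Set.mem_range, Function.Embedding.coe_subtype, not_exists]
      exact ⟨by rintro rfl ⟨x, hx⟩ h; exact hx h, fun h => by_contra fun hs => h ⟨s, hs⟩ rfl⟩)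
  simpa using h

/-- **The formal node `E⟦u, v⟧/(uv)` over a domain is reduced**: `(uv) = (u) ∩ (v)` with `u, v`
prime. [cite: DeJong1996, 2.16, p. 59] -/
theorem chartsOverCentre_isReduced_formalNode {E : Type} [CommRing E] [IsDomain E] :
    IsReduced (MvPowerSeries (Fin 2) E ⧸
      Ideal.span {(MvPowerSeries.X 0 * MvPowerSeries.X 1 : MvPowerSeries (Fin 2) E)}) := by
  classical
  have hp0 := chartsOverCentre_prime_X (E := E) 0
  have hp1 := chartsOverCentre_prime_X (E := E) 1
  refine ⟨fun g hg => ?_⟩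
  obtain ⟨f, rfl⟩ := Ideal.Quotient.mk_surjective g
  obtain ⟨n, hn⟩ := hg
  rw [← map_pow, Ideal.Quotient.eq_zero_iff_mem, Ideal.mem_span_singleton] at hn
  rw [Ideal.Quotient.eq_zero_iff_mem, Ideal.mem_span_singleton]
  have h0 : (MvPowerSeries.X 0 : MvPowerSeries (Fin 2) E) ∣ f :=
    hp0.dvd_of_dvd_pow (dvd_trans (dvd_mul_right _ _) hn)
  have h1 : (MvPowerSeries.X 1 : MvPowerSeries (Fin 2) E) ∣ f :=
    hp1.dvd_of_dvd_pow (dvd_trans (dvd_mul_left _ _) hn)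
  obtain ⟨f₀, rfl⟩ := h0
  rcases hp1.dvd_or_dvd h1 with h | h
  · exfalso
    have := (MvPowerSeries.X_dvd_iff.mp h) (Finsupp.single 0 1) (by simp)
    rw [MvPowerSeries.coeff_X, if_pos rfl] at this
    exact one_ne_zero this
  · exact mul_dvd_mul_left _ h

/-- **`A⟦u, v⟧/(uv - h)` is a Noetherian local ring** for `A` Noetherian local.
[cite: DeJong1996, 2.23, p. 62] -/
theorem chartsOverCentre_isLocalRing_nodeDeformationRing (A : Type) [CommRing A] [IsLocalRing A] (h : A)
    (hh : h ∈ maximalIdeal A) : IsLocalRing (DeJong1996.NodeDeformationRing A h) := by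
  refine isLocalRing_quotient fun htop => ?_
  rw [Ideal.span_singleton_eq_top] at htop
  have := (Literature.NumberTheory.GaloisRepresentations.NearlyOrdinaryPresentationCA.mem_maximalIdeal_mvPowerSeries_iff
    A (DeJong1996.nodeDeformationRelation A h)).mpr (by
    rw [DeJong1996.nodeDeformationRelation, map_sub, map_mul, MvPowerSeries.constantCoeff_X, zero_mul,
      zero_sub, MvPowerSeries.constantCoeff_C]
    exact (maximalIdeal A).neg_mem hh)
  exact (IsLocalRing.mem_maximalIdeal _).mp this htop

/-- Nonzero-divisors modulo one parameter: for `t` part of a regular system of parameters of `D`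
and `d ∉ (t_i)`, the class of the constant `d` is a non-zero-divisor of
`(D⟦u, v⟧/(uv - h))/(t_i) ≅ (D/t_i)⟦u, v⟧/(uv - h̄)` (`D/t_i` is a domain; flatness).
[cite: DeJong1996, 3.5, p. 64] -/
theorem chartsOverCentre_mk_ofBase_mem_nonZeroDivisors {D : Type} [CommRing D] [IsRegularLocalRing D]
    {n : ℕ} {t : Fin n → D} (ht : IsRsopPart t) (h : D) (i : Fin n) {d : D} (hd : d ∉ Ideal.span {t i}) :
    Ideal.Quotient.mk (Ideal.span {DeJong1996.NodeDeformationRing.ofBase D h (t i)})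
        (DeJong1996.NodeDeformationRing.ofBase D h d) ∈
      nonZeroDivisors (DeJong1996.NodeDeformationRing D h ⧸
        Ideal.span {DeJong1996.NodeDeformationRing.ofBase D h (t i)}) := by
  haveI := isRegularLocalRing_quot_zk ht i
  haveI : IsDomain (D ⧸ Ideal.span {t i}) := isDomain_of_isRegularLocalRing _
  obtain ⟨ε, hε⟩ := chartsOverCentre_nodeDeformationRing_quot D h (t i)
  have hne : Ideal.Quotient.mk (Ideal.span {t i}) d ≠ 0 := fun h0 =>
    hd (Ideal.Quotient.eq_zero_iff_mem.mp h0)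
  have hnzd := chartsOverCentre_ofBase_mem_nonZeroDivisors (D ⧸ Ideal.span {t i})
    (Ideal.Quotient.mk _ h) (mem_nonZeroDivisors_of_ne_zero hne)
  rw [← hε] at hnzd
  exact mem_nonZeroDivisors_of_injective (f := ε.toRingHom) ε.injective hnzd

/-- **The model ring `D⟦u, v⟧/(uv - ∏_{k ∈ S} t_k)` is reduced** (`t` part of a regular system of
parameters of the regular local `D`, `S ≠ ∅`): modulo a factor `t_j` of the relation it is the
reduced formal node `(D/t_j)⟦u, v⟧/(uv)`, and `t_j` is a regular parameter
(`chartsOverCentre_isReduced_of_quotient`). [cite: DeJong1996, 2.16 and 2.23, pp. 59, 62] -/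
theorem chartsOverCentre_isReduced_nodeDeformationRing {D : Type} [CommRing D] [IsRegularLocalRing D]
    {n : ℕ} {t : Fin n → D} (ht : IsRsopPart t) (S : Finset (Fin n)) (hS : S.Nonempty) {η : D}
    (hη : η = ∏ k ∈ S, t k) :
    IsReduced (DeJong1996.NodeDeformationRing D η) := by
  classical
  obtain ⟨j, hj⟩ := hS
  haveI hDN : IsNoetherianRing (MvPowerSeries (Fin 2) D) := isNoetherianRing_mvPowerSeries D (Fin 2)
  have hηm : η ∈ maximalIdeal D := by
    rw [hη, ← Finset.mul_prod_erase _ _ hj]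
    exact Ideal.mul_mem_right _ _ (ht.mem_maximalIdeal j)
  haveI := chartsOverCentre_isLocalRing_nodeDeformationRing D η hηm
  haveI := isRegularLocalRing_quot_zk ht j
  haveI : IsDomain (D ⧸ Ideal.span {t j}) := isDomain_of_isRegularLocalRing _
  obtain ⟨ε, -⟩ := chartsOverCentre_nodeDeformationRing_quot D η (t j)
  -- modulo `t_j` the relation becomes `uv`
  have hη0 : Ideal.Quotient.mk (Ideal.span {t j}) η = 0 := by
    rw [Ideal.Quotient.eq_zero_iff_mem, hη, ← Finset.mul_prod_erase _ _ hj]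
    exact Ideal.mul_mem_right _ _ (Ideal.mem_span_singleton_self _)
  have hrel : DeJong1996.nodeDeformationRelation (D ⧸ Ideal.span {t j}) (Ideal.Quotient.mk _ η) =
      MvPowerSeries.X 0 * MvPowerSeries.X 1 := by
    rw [DeJong1996.nodeDeformationRelation, hη0, map_zero, sub_zero]
  have hred : IsReduced (DeJong1996.NodeDeformationRing D η ⧸
      Ideal.span {DeJong1996.NodeDeformationRing.ofBase D η (t j)}) := by
    have h2 : IsReduced (DeJong1996.NodeDeformationRing (D ⧸ Ideal.span {t j}) (Ideal.Quotient.mk _ η)) := by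
      have e' : DeJong1996.NodeDeformationRing (D ⧸ Ideal.span {t j}) (Ideal.Quotient.mk _ η) ≃+*
          (MvPowerSeries (Fin 2) (D ⧸ Ideal.span {t j}) ⧸
            Ideal.span {(MvPowerSeries.X 0 * MvPowerSeries.X 1 : MvPowerSeries (Fin 2) (D ⧸ Ideal.span {t j}))}) :=
        Ideal.quotEquivOfEq (by rw [hrel])
      haveI := chartsOverCentre_isReduced_formalNode (E := D ⧸ Ideal.span {t j})
      exact isReduced_of_injective e'.toRingHom e'.injective
    exact isReduced_of_injective ε.toRingHom ε.injective
  refine chartsOverCentre_isReduced_of_quotient ?_ ?_ hred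
  · -- `t_j` is not a unit of the model ring: the quotient by it is non-trivial
    rw [IsLocalRing.mem_maximalIdeal, mem_nonunits_iff]
    intro hu
    have hsub : Subsingleton (DeJong1996.NodeDeformationRing D η ⧸
        Ideal.span {DeJong1996.NodeDeformationRing.ofBase D η (t j)}) :=
      Ideal.Quotient.subsingleton_iff.mpr (Ideal.eq_top_of_isUnit_mem _ (Ideal.mem_span_singleton_self _) hu)
    haveI : Nontrivial (DeJong1996.NodeDeformationRing (D ⧸ Ideal.span {t j}) (Ideal.Quotient.mk _ η)) := by
      haveI := chartsOverCentre_isLocalRing_nodeDeformationRing (D ⧸ Ideal.span {t j}) (Ideal.Quotient.mk _ η)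
        (by rw [hη0]; exact Ideal.zero_mem _)
      infer_instance
    exact not_subsingleton _ (ε.symm.injective.subsingleton)
  · haveI : IsDomain D := isDomain_of_isRegularLocalRing D
    exact chartsOverCentre_ofBase_mem_nonZeroDivisors D η (mem_nonZeroDivisors_of_ne_zero (ht.ne_zero j))

/-- **Modulo any parameter `t_i` the model ring `D⟦u, v⟧/(uv - ∏_{k ∈ S} t_k)` stays reduced**:
it is `(D/t_i)⟦u, v⟧/(uv - η̄)` with `η̄ = 0` (formal node) if `i ∈ S`, and otherwise the model
ring of the regular local `D/t_i` with the induced parameters. [cite: DeJong1996, 2.16, p. 59] -/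
theorem chartsOverCentre_isReduced_nodeDeformationRing_quot {D : Type} [CommRing D] [IsRegularLocalRing D]
    {n : ℕ} {t : Fin n → D} (ht : IsRsopPart t) (S : Finset (Fin n)) (hS : S.Nonempty) {η : D}
    (hη : η = ∏ k ∈ S, t k) (i : Fin n) :
    IsReduced (DeJong1996.NodeDeformationRing D η ⧸
      Ideal.span {DeJong1996.NodeDeformationRing.ofBase D η (t i)}) := by
  classical
  haveI := isRegularLocalRing_quot_zk ht i
  haveI : IsDomain (D ⧸ Ideal.span {t i}) := isDomain_of_isRegularLocalRing _
  obtain ⟨ε, -⟩ := chartsOverCentre_nodeDeformationRing_quot D η (t i)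
  suffices h : IsReduced (DeJong1996.NodeDeformationRing (D ⧸ Ideal.span {t i}) (Ideal.Quotient.mk _ η)) from
    isReduced_of_injective ε.toRingHom ε.injective
  by_cases hi : i ∈ S
  · -- `η ≡ 0`: the formal node
    have hη0 : Ideal.Quotient.mk (Ideal.span {t i}) η = 0 := by
      rw [Ideal.Quotient.eq_zero_iff_mem, hη, ← Finset.mul_prod_erase _ _ hi]
      exact Ideal.mul_mem_right _ _ (Ideal.mem_span_singleton_self _)
    have hrel : DeJong1996.nodeDeformationRelation (D ⧸ Ideal.span {t i}) (Ideal.Quotient.mk _ η) =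
        MvPowerSeries.X 0 * MvPowerSeries.X 1 := by
      rw [DeJong1996.nodeDeformationRelation, hη0, map_zero, sub_zero]
    have e' : DeJong1996.NodeDeformationRing (D ⧸ Ideal.span {t i}) (Ideal.Quotient.mk _ η) ≃+*
        (MvPowerSeries (Fin 2) (D ⧸ Ideal.span {t i}) ⧸
          Ideal.span {(MvPowerSeries.X 0 * MvPowerSeries.X 1 : MvPowerSeries (Fin 2) (D ⧸ Ideal.span {t i}))}) :=
      Ideal.quotEquivOfEq (by rw [hrel])
    haveI := chartsOverCentre_isReduced_formalNode (E := D ⧸ Ideal.span {t i})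
    exact isReduced_of_injective e'.toRingHom e'.injective
  · -- `i ∉ S`: the model ring of `D/t_i` with the induced parameters
    cases n with
    | zero => exact Fin.elim0 i
    | succ n' =>
      -- the parameters other than `t_i`, as a part of a regular system of parameters of `D/t_i`
      have hcons : IsRsopPart (Fin.cons (t i) (t ∘ i.succAbove) : Fin (n' + 1) → D) := by
        have := ht.comp (Fin.cons i i.succAbove : Fin (n' + 1) → Fin (n' + 1)) (by
          intro a b hab
          induction a using Fin.cases with
          | zero => induction b using Fin.cases with
            | zero => rfl
            | succ b => exact absurd hab.symm (Fin.succAbove_ne i b)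
          | succ a => induction b using Fin.cases with
            | zero => exact absurd hab (Fin.succAbove_ne i a)
            | succ b => simp only [Fin.cons_succ] at hab; rw [Fin.succAbove_right_injective hab])
        convert this using 1
        funext a
        induction a using Fin.cases with
        | zero => rfl
        | succ a => rfl
      have ht' := isRsopPart_quotient_cons hcons
      -- `η̄` is the product over the preimage of `S`
      have hSsub : ∀ k ∈ S, k ≠ i := fun k hk h => hi (h ▸ hk)
      let S'' : Finset (Fin n') := S.preimage i.succAbove (Fin.succAbove_right_injective.injOn)
      have hS'' : S''.Nonempty := by
        obtain ⟨k, hk⟩ := hS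
        obtain ⟨k'', hk''⟩ := Fin.exists_succAbove_eq (hSsub k hk)
        exact ⟨k'', Finset.mem_preimage.mpr (hk'' ▸ hk)⟩
      have hη' : Ideal.Quotient.mk (Ideal.span {t i}) η =
          ∏ k ∈ S'', (Ideal.Quotient.mk (Ideal.span {t i}) ∘ (t ∘ i.succAbove)) k := by
        rw [hη, map_prod]
        have himage : S = S''.map i.succAboveEmb := by
          ext k
          simp only [Finset.mem_map, Finset.mem_preimage, Fin.coe_succAboveEmb, S'']
          constructor
          · intro hk
            obtain ⟨k'', hk''⟩ := Fin.exists_succAbove_eq (hSsub k hk)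
            exact ⟨k'', hk'' ▸ hk, hk''⟩
          · rintro ⟨k'', hk'', rfl⟩
            exact hk''
        rw [himage, Finset.prod_map]
        rfl
      exact chartsOverCentre_isReduced_nodeDeformationRing ht' S'' hS'' hη'

/-- **The boundary ideal `(∏_{k ∈ R} t_k)` of the model ring `D⟦u, v⟧/(uv - ∏_{k ∈ S} t_k)` is
radical** (`∅ ≠ S`, any `R`): it is the intersection of the radical ideals `(t_i)`, `i ∈ R`
(for the intersection: the remaining product is a non-zero-divisor modulo `t_i`). This is "`Z`
is given by `t₁ ⋯ t_r = 0`" as an equality of IDEALS in the normal form 4.25/2.16.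
[cite: DeJong1996, 4.25, p. 75] [cite: DeJong1996, 2.16, p. 59] -/
theorem chartsOverCentre_isRadical_span_ofBase_prod {D : Type} [CommRing D] [IsRegularLocalRing D]
    {n : ℕ} {t : Fin n → D} (ht : IsRsopPart t) (S R : Finset (Fin n)) (hS : S.Nonempty) {η : D}
    (hη : η = ∏ k ∈ S, t k) :
    (Ideal.span {DeJong1996.NodeDeformationRing.ofBase D η (∏ k ∈ R, t k)}).IsRadical := by
  classical
  -- the product ideal is the intersection of the `(t_i)`
  have key : ∀ R : Finset (Fin n), Ideal.span {DeJong1996.NodeDeformationRing.ofBase D η (∏ k ∈ R, t k)} =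
      ⨅ i ∈ R, Ideal.span {DeJong1996.NodeDeformationRing.ofBase D η (t i)} := by
    intro R
    induction R using Finset.induction_on with
    | empty => simp
    | insert i R hi ih =>
      rw [Finset.prod_insert hi, map_mul, Finset.iInf_insert, ← ih]
      apply le_antisymm
      · refine le_inf ?_ ?_
        · rw [Ideal.span_singleton_le_iff_mem]
          exact Ideal.mul_mem_right _ _ (Ideal.mem_span_singleton_self _)
        · rw [Ideal.span_singleton_le_iff_mem]
          exact Ideal.mul_mem_left _ _ (Ideal.mem_span_singleton_self _)
      · intro z hz
        obtain ⟨hz1, hz2⟩ := Ideal.mem_inf.mp hz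
        obtain ⟨b, rfl⟩ := Ideal.mem_span_singleton'.mp hz2
        -- modulo `t_i`, `b · ∏_R t = 0` with `∏_R t` a non-zero-divisor, so `t_i ∣ b`
        have hnzd := chartsOverCentre_mk_ofBase_mem_nonZeroDivisors ht η i (d := ∏ k ∈ R, t k) (by
          intro hmem
          rw [Ideal.mem_span_singleton] at hmem
          haveI := isDomain_of_isRegularLocalRing D
          obtain ⟨k, hk, hdk⟩ := (ht.prime i).exists_mem_finset_dvd hmem
          exact ht.not_dvd (fun h => hi (by rw [h]; exact hk)) hdk)
        have hprod : Ideal.Quotient.mk (Ideal.span {DeJong1996.NodeDeformationRing.ofBase D η (t i)}) b *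
            Ideal.Quotient.mk (Ideal.span {DeJong1996.NodeDeformationRing.ofBase D η (t i)})
              (DeJong1996.NodeDeformationRing.ofBase D η (∏ k ∈ R, t k)) = 0 := by
          rw [← RingHom.map_mul, Ideal.Quotient.eq_zero_iff_mem]
          exact hz1
        have hb : Ideal.Quotient.mk (Ideal.span {DeJong1996.NodeDeformationRing.ofBase D η (t i)}) b = 0 :=
          hnzd.2 _ hprod
        have hb' : b ∈ Ideal.span {DeJong1996.NodeDeformationRing.ofBase D η (t i)} :=
          Ideal.Quotient.eq_zero_iff_mem.mp hb
        obtain ⟨b', rfl⟩ := Ideal.mem_span_singleton'.mp hb'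
        rw [mul_assoc]
        exact Ideal.mul_mem_left _ _ (Ideal.mem_span_singleton_self _)
  have hrad : ∀ i : Fin n, (Ideal.span {DeJong1996.NodeDeformationRing.ofBase D η (t i)}).IsRadical :=
    fun i => (Ideal.isRadical_iff_quotient_reduced _).mpr
      (chartsOverCentre_isReduced_nodeDeformationRing_quot ht S hS hη i)
  rw [key]
  exact Ideal.isRadical_iInf _ fun i => Ideal.isRadical_iInf _ fun _ => hrad i

end Summit.ResolutionOfSingularities.ResolutionOfSingularities.Theorems

end
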